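import Summits.Schanuel.Schanuel.Theorems.RootDecomp1KHyper76

/-!
# RootDecomp1KHyper — lens 6, generation 18 «BILOG STAIRCASE CELL — THE MEMBER PACKAGE Q1/Q2» (BilogStair.lean EDITION 9 c88597c7…5692, 6929 l; §T appended, §A–§S byte-identical to edition 8 = tree `RootDecomp1KHyper53`–`75`) — continuation (RootDecomp1KHyper77): §T.3 the forms of `z_B`, the planted forms, LEMMA P for `z_B` (`smallFormsArePlanted_zB_of`)

(lens-6 g18 `BilogStair.lean` EDITION 9, sha256 c88597c719d23fd42e88a1c5ede12e838e786bf53aa652e8b381b4b663795692, 6929 l, own farm rc 0 · 0 warn · 0 sorry · axioms std; §A–§S = editions 2–8 (ported as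
`RootDecomp1KHyper53`–`75`), ONE import line (`RootDecomp1KHyper51`, the tree's `HasMeasuredRatAnchor`) ADDED and §T appended in edition 9 (NOTE/CLAIM L1849, critic ACK L1855, NODE/EDITION9 L1872 / REQUEST L1873 / RESULT L1874, writer re-check L1877, critic VERDICT L1879 (CLEARED; the reserved K-R20 THIRD⁗ CELL credit AWARDED to lens-6; port GO));
port by census-1 gen 17 as `RootDecomp1KHyper76`–`79`: 76 = §T.1 `PiEllMeasure`, the Baker 1975 Thm 3.1 copy `Baker1975Thm31` (character-identical to
`Literature.NumberTheory.Transcendental.baker1975_thm_3_1`, consumed BY NAME; TODO: replace by the import + `baker1975_thm_3_1_holds` when the Baker chain builds on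
the farm), `piEllMeasure_of_baker` + §T.2 the good level of the tower; 77 = §T.3 the forms of `z_B`, `SmallFormsArePlantedAt`, LEMMA P `smallFormsArePlanted_zB_of`;
78 = §T.4 the tuple-generic PLANTED-STAIRCASE CRITERION `not_hasHLPairInSpan_of_planted` + `not_hasHLPairInSpan_zB_of` / `not_hasHLPairInSpan_zB_of_baker` (Q1);
79 = §T.5 the `HasMeasuredRatAnchor` placement of `z_B` (Q2: `exists_measured_pair_of_hasMeasuredRatAnchor_zB`, `logLattice_mem_of_hasMeasuredRatAnchor_zB`,
`hasMeasuredRatAnchor_zB_of_mvWeakMeasure`/`'`) + §T.6 `placement_zB''`. PORT EDITS: generic one-liners `mul_le_pow_of_two_le` / `sq_le_two_pow_pred` / `two_pow_le_exp_nat` /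
`half_le_ell` / `tau_lt_one` / `mvaeval_mem_adjoin` private (+ per-part private copies of earlier private helpers); statements and proofs verbatim. `--supports stmt-Schanuel-33363`;
no census credit carried; rung 0 — nothing here proves HyperLiouvilleSchanuel in general.)
-/

open Complex Polynomial IntermediateField Filter
open scoped BigOperators

namespace Summit.Schanuel.Schanuel.Theorems.RootDecomp1KHyper

namespace HyperCell

namespace LatCell

namespace Bilog

variable {n : ℕ}
open Summit.Schanuel.Schanuel.Theorems.RootDecomp1KRelLiouvilleCell (mvPolyMeasure_one_of_polyMeasure ycoeff
  mvaeval_cons_eq_sum mvlen_ycoeff_le natDegree_finSuccEquiv_le_totalDegree norm_mvaeval_le_mvlen_mul_pow)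

open Summit.Schanuel.Schanuel.Theorems.RootDecomp1KGeneric (norm_mvAeval_sub_le norm_cexp_sub_cexp_le lenMv
  lenMv_nonneg)

section MemberPkg

open Summit.Schanuel.Schanuel.Theorems.RootDecomp1KGeneric (HasHLPairInSpan)

/-- `2^A ≤ exp A`. -/
private theorem two_pow_le_exp_nat (A : ℕ) : (2 : ℝ) ^ A ≤ Real.exp A := by
  calc (2 : ℝ) ^ A ≤ Real.exp 1 ^ A :=
        pow_le_pow_left₀ (by norm_num) (by have := Real.add_one_le_exp (1 : ℝ); linarith) A
    _ = Real.exp A := by rw [← Real.exp_nat_mul, mul_one]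

/-! ### §T.3  The forms of `z_B`, the planted forms, and LEMMA P for `z_B` -/

/-- A form `h · z_B` is `i` times the real number `h₀π + h₁ℓ₀ + h₂y_B`. -/
theorem form_zB (h : Fin 3 → ℤ) :
    ∑ i, (h i : ℂ) * zB i =
      ((((h 0 : ℝ) * Real.pi + (h 1 : ℝ) * ell + (h 2 : ℝ) * yB : ℝ)) : ℂ) * I := by
  simp only [Fin.sum_univ_three, zB, Matrix.cons_val_zero, Matrix.cons_val_one, Matrix.cons_val_two,
    Matrix.head_cons, Matrix.tail_cons]
  push_cast
  ring

/-- The norm of a form of `z_B`. -/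
theorem norm_form_zB (h : Fin 3 → ℤ) :
    ‖∑ i, (h i : ℂ) * zB i‖ = |(h 0 : ℝ) * Real.pi + (h 1 : ℝ) * ell + (h 2 : ℝ) * yB| := by
  rw [form_zB, norm_mul, Complex.norm_I, mul_one, Complex.norm_real, Real.norm_eq_abs]

/-- **LEMMA P at a tuple** (statement, the tree's `SmallFormsArePlanted` made tuple-generic): every sufficiently
small integer form of `z` is an integer multiple of a planted form `h_K = (−P_K, −M_K, 2^{a_K})`. -/
def SmallFormsArePlantedAt (z : Fin 3 → ℂ) : Prop :=
  ∃ m₀ : ℕ, ∀ h : Fin 3 → ℤ, h ≠ 0 →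
    ‖∑ i, (h i : ℂ) * z i‖ < Real.exp (-((1 + ∑ i, |(h i : ℝ)|) ^ m₀)) →
      ∃ (K : ℕ) (t : ℤ), h = t • hKvec K

set_option maxHeartbeats 1600000 in
/-- **LEMMA P for `z_B`** (mod `PiEllMeasure`, level `m₀ = 4(κ+2)²(κ+16)`).  Fix `h ≠ 0` of height `N = |h|₁`,
`F = h₀π + h₁ℓ₀ + h₂y_B`, and the good level `K` of §T.2.  Then `2^{a_K} F = (U π + V ℓ₀) + h₂ 2^{a_K} err_K` with
the INTEGERS `U = 2^{a_K}h₀ + h₂P_K`, `V = 2^{a_K}h₁ + h₂M_K` of size `≤ 2·2^{a_K}N` and `0 < err_K ≤ 10·2^{−a_{K+1}}`.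
If `(U, V) ≠ 0` the measure gives `|Uπ + Vℓ₀| ≥ T^{−κ}`, `T = 8·2^{a_K}N`, the perturbation is `≤ ½T^{−κ}`
(`T^{κ+2} ≤ 2^{a_{K+1}}`), so `|F| ≥ T^{−(κ+2)}`; but `|F| < exp(−(1+N)^{m₀}) ≤ 2^{−(3+X+N)(κ+2)} ≤ T^{−(κ+2)}`
(`a_K < X`).  Hence `U = V = 0`, and the parity of `P_K, M_K` gives `2^{a_K} ∣ h₂`, `h = (h₂/2^{a_K})·h_K`. -/
theorem smallFormsArePlanted_zB_of (hM : PiEllMeasure) : SmallFormsArePlantedAt zB := by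
  obtain ⟨κ, hκ⟩ := hM
  refine ⟨4 * (κ + 2) ^ 2 * (κ + 16), fun h hh0 hsmall => ?_⟩
  -- the height N = |h|₁
  obtain ⟨N, hN⟩ : ∃ N : ℕ, N = ∑ i, (h i).natAbs := ⟨_, rfl⟩
  have hNR : (N : ℝ) = ∑ i, |(h i : ℝ)| := by
    rw [hN]; push_cast
    refine Finset.sum_congr rfl fun i _ => ?_
    rw [Nat.cast_natAbs, Int.cast_abs]
  have hN1 : 1 ≤ N := by
    obtain ⟨k, hk⟩ := Function.ne_iff.mp hh0
    have h1 : 1 ≤ (h k).natAbs := Int.natAbs_pos.mpr hk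
    rw [hN]
    exact le_trans h1 (Finset.single_le_sum (f := fun i => (h i).natAbs) (fun i _ => Nat.zero_le _)
      (Finset.mem_univ k))
  have hNR1 : (1 : ℝ) ≤ N := by exact_mod_cast hN1
  have hNpos : (0 : ℝ) < N := by linarith
  have habs_i : ∀ i, |(h i : ℝ)| ≤ N := fun i => by
    rw [hNR]
    exact Finset.single_le_sum (f := fun j => |(h j : ℝ)|) (fun j _ => abs_nonneg _) (Finset.mem_univ i)
  have h01 : |(h 0 : ℝ)| + |(h 1 : ℝ)| ≤ N := by
    rw [hNR, Fin.sum_univ_three]; linarith only [abs_nonneg (h 2 : ℝ)]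
  rw [norm_form_zB, ← hNR] at hsmall
  -- the good level
  obtain ⟨K, hKX, hKgood⟩ := exists_goodLevel κ N
  have hexpo := level_exponent_le κ N hN1
  set X : ℕ := 2 * (κ + 2) * (N + κ + 16) with hX
  set E : ℝ := (2 : ℝ) ^ hexp K with hE
  have hE2 : (2 : ℝ) ≤ E := by
    calc (2 : ℝ) = 2 ^ 1 := by norm_num
      _ ≤ 2 ^ hexp K := pow_le_pow_right₀ (by norm_num) (one_le_hexp K)
  have hEpos : (0 : ℝ) < E := by positivity
  have hEN : (2 : ℝ) ≤ E * N := by nlinarith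
  set T : ℝ := 8 * E * N with hT
  have hTpos : (0 : ℝ) < T := by positivity
  have hgoodR : T ^ (κ + 2) ≤ (2 : ℝ) ^ hexp (K + 1) := by
    have h' : (((8 * 2 ^ hexp K * N) ^ (κ + 2) : ℕ) : ℝ) ≤ ((2 ^ hexp (K + 1) : ℕ) : ℝ) := by
      exact_mod_cast hKgood
    push_cast at h'
    rw [hT, hE]
    exact h'
  -- the tail and the decomposition `E·F = (Uπ + Vℓ₀) + h₂ (E t)`
  have htpos := err_pos K
  have htle := err_le K
  set t : ℝ := yB - ((aB K : ℝ) * Real.pi + (bB K : ℝ) * ell) with ht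
  obtain ⟨U, hU⟩ : ∃ U : ℤ, U = ((2 ^ hexp K : ℕ) : ℤ) * h 0 + h 2 * (pmP K : ℤ) := ⟨_, rfl⟩
  obtain ⟨V, hV⟩ : ∃ V : ℤ, V = ((2 ^ hexp K : ℕ) : ℤ) * h 1 + h 2 * (pmM K : ℤ) := ⟨_, rfl⟩
  have h2pos : (0 : ℝ) < (2 : ℝ) ^ hexp K := by positivity
  have hid : E * ((h 0 : ℝ) * Real.pi + (h 1 : ℝ) * ell + (h 2 : ℝ) * yB) =
      ((U : ℝ) * Real.pi + (V : ℝ) * ell) + (h 2 : ℝ) * (E * t) := by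
    have hy : yB = (aB K : ℝ) * Real.pi + (bB K : ℝ) * ell + t := by rw [ht]; ring
    rw [hy, hU, hV, hE]
    unfold aB bB
    push_cast
    field_simp
    ring
  by_cases hUV : U = 0 ∧ V = 0
  · -- the planted case
    obtain ⟨hU0, hV0⟩ := hUV
    have hdvd : ((2 ^ hexp K : ℕ) : ℤ) ∣ h 2 := by
      by_cases hK : Even K
      · have hP : Odd (pmP K) := (odd_pmP_iff K).mpr hK
        have hcop : IsCoprime ((2 ^ hexp K : ℕ) : ℤ) (pmP K : ℤ) := by
          rw [Nat.isCoprime_iff_coprime]; exact (Nat.coprime_two_left.2 hP).pow_left _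
        exact hcop.dvd_of_dvd_mul_right ⟨-h 0, by linear_combination hU0 - hU⟩
      · have hM : Odd (pmM K) := (odd_pmM_iff K).mpr hK
        have hcop : IsCoprime ((2 ^ hexp K : ℕ) : ℤ) (pmM K : ℤ) := by
          rw [Nat.isCoprime_iff_coprime]; exact (Nat.coprime_two_left.2 hM).pow_left _
        exact hcop.dvd_of_dvd_mul_right ⟨-h 1, by linear_combination hV0 - hV⟩
    obtain ⟨t', ht'⟩ := hdvd
    have h2A0 : ((2 ^ hexp K : ℕ) : ℤ) ≠ 0 := by positivity
    have hh0' : h 0 = -(t' * pmP K) := by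
      apply mul_left_cancel₀ h2A0
      linear_combination hU0 - hU - (pmP K : ℤ) * ht'
    have hh1' : h 1 = -(t' * pmM K) := by
      apply mul_left_cancel₀ h2A0
      linear_combination hV0 - hV - (pmM K : ℤ) * ht'
    refine ⟨K, t', ?_⟩
    funext i
    match i with
    | 0 => rw [Pi.smul_apply, smul_eq_mul, hKvec_zero, hh0']; ring
    | 1 => rw [Pi.smul_apply, smul_eq_mul, hKvec_one, hh1']; ring
    | 2 => rw [Pi.smul_apply, smul_eq_mul, hKvec_two, ht']; ring
  · -- the generic case is impossible
    exfalso
    have hUV' : U ≠ 0 ∨ V ≠ 0 := by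
      by_cases hU0 : U = 0
      · exact Or.inr fun hV0 => hUV ⟨hU0, hV0⟩
      · exact Or.inl hU0
    -- sizes of U, V
    have hPM := pmP_add_pmM_le_pow K
    have hUVle : |(U : ℝ)| + |(V : ℝ)| ≤ 2 * E * N := by
      rw [hU, hV]; push_cast; rw [← hE]
      have e1 : |E * h 0 + h 2 * (pmP K : ℝ)| ≤ E * |(h 0 : ℝ)| + |(h 2 : ℝ)| * pmP K := by
        calc _ ≤ |E * h 0| + |(h 2 : ℝ) * (pmP K : ℝ)| := abs_add_le _ _
          _ = _ := by rw [abs_mul, abs_mul, abs_of_pos hEpos, Nat.abs_cast]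
      have e2 : |E * h 1 + h 2 * (pmM K : ℝ)| ≤ E * |(h 1 : ℝ)| + |(h 2 : ℝ)| * pmM K := by
        calc _ ≤ |E * h 1| + |(h 2 : ℝ) * (pmM K : ℝ)| := abs_add_le _ _
          _ = _ := by rw [abs_mul, abs_mul, abs_of_pos hEpos, Nat.abs_cast]
      have e3 : |(h 2 : ℝ)| * ((pmP K : ℝ) + pmM K) ≤ N * E := by
        rw [hE]; exact mul_le_mul (habs_i 2) hPM (by positivity) (by positivity)
      have e4 : E * (|(h 0 : ℝ)| + |(h 1 : ℝ)|) ≤ E * N := mul_le_mul_of_nonneg_left h01 hEpos.le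
      linarith only [e1, e2, e3, e4]
    -- the main term
    have hmain : 1 / T ^ κ ≤ |(U : ℝ) * Real.pi + (V : ℝ) * ell| := by
      refine le_trans ?_ (piEllMeasure_apply hκ U V hUV')
      apply one_div_le_one_div_of_le (by positivity)
      apply pow_le_pow_left₀ (by positivity)
      rw [hT]; nlinarith only [hUVle, hEN]
    -- the perturbation
    have hpert : |(h 2 : ℝ) * (E * t)| ≤ 10 * E * N / T ^ (κ + 2) := by
      rw [abs_mul, abs_of_pos (mul_pos hEpos htpos)]
      have h2K : (0 : ℝ) < 2 ^ hexp (K + 1) := by positivity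
      calc |(h 2 : ℝ)| * (E * t) ≤ N * (E * (10 * (1 / (2 : ℝ) ^ hexp (K + 1)))) :=
            mul_le_mul (habs_i 2) (mul_le_mul_of_nonneg_left htle hEpos.le)
              (by positivity) (by positivity)
        _ = 10 * E * N / 2 ^ hexp (K + 1) := by ring
        _ ≤ 10 * E * N / T ^ (κ + 2) := div_le_div_of_nonneg_left (by positivity) (by positivity) hgoodR
    have hpert' : 10 * E * N / T ^ (κ + 2) ≤ 1 / (2 * T ^ κ) := by
      rw [div_le_div_iff₀ (by positivity) (by positivity), pow_add]
      have hk : (0 : ℝ) < T ^ κ := by positivity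
      have hm : 0 ≤ E * N * T ^ κ := by positivity
      have hm2 : 2 * (E * N * T ^ κ) ≤ (E * N) * (E * N * T ^ κ) := mul_le_mul_of_nonneg_right hEN hm
      rw [hT]
      nlinarith only [hm, hm2]
    -- lower bound for E |F|
    have hFlow : 1 / (2 * T ^ κ) ≤ E * |(h 0 : ℝ) * Real.pi + (h 1 : ℝ) * ell + (h 2 : ℝ) * yB| := by
      have htri : |(U : ℝ) * Real.pi + (V : ℝ) * ell| ≤
          |E * ((h 0 : ℝ) * Real.pi + (h 1 : ℝ) * ell + (h 2 : ℝ) * yB)| + |(h 2 : ℝ) * (E * t)| := by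
        rw [hid]
        calc |(U : ℝ) * Real.pi + (V : ℝ) * ell|
            = |((U : ℝ) * Real.pi + (V : ℝ) * ell + (h 2 : ℝ) * (E * t)) - (h 2 : ℝ) * (E * t)| := by
                rw [add_sub_cancel_right]
          _ ≤ _ := abs_sub _ _
      rw [abs_mul, abs_of_pos hEpos] at htri
      have e : 1 / (2 * T ^ κ) = 1 / T ^ κ - 1 / (2 * T ^ κ) := by field_simp; ring
      linarith only [hmain, hpert, hpert', htri, e]
    have hFlow' : 1 / T ^ (κ + 2) ≤ |(h 0 : ℝ) * Real.pi + (h 1 : ℝ) * ell + (h 2 : ℝ) * yB| := by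
      have h1 : 1 / T ^ (κ + 2) ≤ 1 / (2 * T ^ κ * E) := by
        apply one_div_le_one_div_of_le (by positivity)
        rw [pow_add]
        have hk : (0 : ℝ) < T ^ κ := by positivity
        have hT2 : 2 * E ≤ T ^ 2 := by rw [hT]; nlinarith only [hEN, hEpos, hNR1]
        nlinarith only [hk, hT2]
      have h2 : 1 / (2 * T ^ κ * E) ≤ |(h 0 : ℝ) * Real.pi + (h 1 : ℝ) * ell + (h 2 : ℝ) * yB| := by
        rw [div_le_iff₀ (by positivity)]
        have := hFlow
        rw [div_le_iff₀ (by positivity)] at this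
        calc (1 : ℝ) ≤ E * |(h 0 : ℝ) * Real.pi + (h 1 : ℝ) * ell + (h 2 : ℝ) * yB| * (2 * T ^ κ) := this
          _ = _ := by ring
      exact h1.trans h2
    -- upper bound from smallness
    have hup : Real.exp (-((1 + (N : ℝ)) ^ (4 * (κ + 2) ^ 2 * (κ + 16)))) ≤ 1 / T ^ (κ + 2) := by
      have h1 : Real.exp (-((1 + (N : ℝ)) ^ (4 * (κ + 2) ^ 2 * (κ + 16)))) ≤
          Real.exp (-(((3 + X + N) * (κ + 2) : ℕ) : ℝ)) := by
        apply Real.exp_le_exp.mpr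
        apply neg_le_neg
        exact_mod_cast hexpo
      have h2 : Real.exp (-(((3 + X + N) * (κ + 2) : ℕ) : ℝ)) ≤ 1 / (2 : ℝ) ^ ((3 + X + N) * (κ + 2)) := by
        rw [Real.exp_neg, ← one_div]
        exact one_div_le_one_div_of_le (by positivity) (two_pow_le_exp_nat _)
      have h3 : 1 / (2 : ℝ) ^ ((3 + X + N) * (κ + 2)) ≤ 1 / T ^ (κ + 2) := by
        apply one_div_le_one_div_of_le (by positivity)
        rw [pow_mul]
        apply pow_le_pow_left₀ hTpos.le
        have hEX : E ≤ (2 : ℝ) ^ X := by rw [hE]; exact pow_le_pow_right₀ (by norm_num) hKX.le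
        have hN2 : (N : ℝ) ≤ (2 : ℝ) ^ N := by exact_mod_cast (Nat.lt_two_pow_self (n := N)).le
        rw [pow_add, pow_add, hT]
        calc 8 * E * (N : ℝ) ≤ 8 * 2 ^ X * 2 ^ N := by gcongr
          _ = (2 : ℝ) ^ 3 * 2 ^ X * 2 ^ N := by norm_num
      exact h1.trans (h2.trans h3)
    linarith only [hFlow', hup, hsmall]

end MemberPkg

end Bilog
end LatCell
end HyperCell
end Summit.Schanuel.Schanuel.Theorems.RootDecomp1KHyper
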